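import Summits.CriticalPhenomena.PercolationContinuityZ3.Theses.PercBoundarySqueeze
import Summits.CriticalPhenomena.PercolationContinuityZ3.Theorems.PercNonProliferationFreeBoxPowerSavingBoundaryInteriorSplit

/-!
# `Lines/birth.lean` — birth skeleton for crux `PercBoundarySqueeze.FreeBoxFatClusterMass`
(item stmt-CriticalPhenomena-6982 · route route-CriticalPhenomena-PercBoundarySqueeze · sub-problem
`PercolationContinuityZ3` · skeleton-register by planner-skel-stmt-CriticalPhenomena-6982-0, 2026-08-17)

**Crux (rank 2, "where the absurd world dies").** `FreeBoxFatClusterMass` (Q2 of the route): at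
`p = p_c(ℤ³)` there are `δ > 0`, `C` with, for every `R ≥ 1`,
`Σ_{x ∈ Λ_R} P(|C_{Λ_R}(x)| ≥ ⌊R^{3/2}⌋) ≤ C · R^{3 − δ}`,
`Λ_R = box 3 R`, `C_{Λ_R}(x)` = the in-box PIECE of `x` (vertices joined to `x` by an open path inside
`Λ_R`), the event being typed as "some finset `T` with `Nat.sqrt (R^3) ≤ #T` is joined to `x` inside
`Λ_R`".  In words: the sites of the free box lying in FAT pieces (`≥ R^{3/2}` vertices) have expected
number polynomially below the volume.

**The skeleton = the free-boundary TOPOLOGICAL split of fat pieces (exit pieces / sealed pieces).**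
A fat piece either touches the inner vertex boundary `∂ⁱⁿΛ_R` (an EXIT piece — on the jump branch
`θ(p_c) > 0` every in-box piece of the infinite cluster is of this kind) or it avoids `∂ⁱⁿΛ_R`
(a SEALED piece).  On the full-measure event `ω ⊆ E(ℤ³)` a sealed piece is a whole, FINITE cluster of
`ℤ³` (`FreeBoxPowerSavingLine.BoundaryInteriorSplit.mem_piece_of_reachable`, in tree): an open path
leaving `Λ_R` leaves through `∂ⁱⁿΛ_R`.  Hence the mass of sealed fat pieces is at most
`Σ_{x ∈ Λ_R} P(R ≤ |C(x)| < ∞) = |Λ_R| · P(R ≤ |C(0)| < ∞)` (translation invariance,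
`bondPercolation_real_preimage_shift`; `⌊R^{3/2}⌋ ≥ R`).  So the crux follows from

* `stub_finiteClusterTail` — **a power-law upper tail for the volume of the FINITE critical
  cluster**: `∃ c₀ > 0, C: P_{p_c}(|C(0)| < ∞ ∧ s ≤ |C(0)|) ≤ C s^{−c₀}` for all real `s ≥ 1`
  ("`1/δ > 0` for finite clusters").  VERBATIM the hypothesis of the kernel-checked exchange rate
  `FreeBoxPowerSavingLine.ExchangeRates.confinedQuasiGiantsVanish_of_finiteClusterTail` of the sibling
  crux `PercNonProliferation.FreeBoxPowerSaving` (stmt-4447), so one proof serves both cruxes.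
  Jump-free (in a `θ(p_c) > 0` world it constrains only finite clusters; it neither implies
  `θ(p_c) = 0` nor is implied by it); in the orthodox picture `c₀ = τ − 2 = 1/δ ≈ 0.19`.  OPEN for
  `ℤ³`: in print only the Aizenman–Barsky LOWER bound `P_{p_c}(|C| ≥ s) ≥ c s^{−1/2}` (Grimmett1999
  Prop. 10.29) and mean field `d > 6`; Hutchcroft 2020 (arXiv:1901.10363) Thm 1.1 ASSUMES such a
  bound.  Size L–XL.
* `stub_exitFatMass` — **fat EXIT pieces carry polynomially sub-volume mass**:
  `∃ δ > 0, C: ∀ R ≥ 1, Σ_{x ∈ Λ_R} P(|C_{Λ_R}(x)| ≥ ⌊R^{3/2}⌋ ∧ x ↔ ∂ⁱⁿΛ_R inside Λ_R) ≤ C R^{3−δ}`.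
  This is the crux's boundary content and the part the route's assembly (`FreeBoxSqueeze`, proved)
  actually consumes; it is where the jump branch dies (a dense box giant touching `∂Λ_R` violates
  it), and it is NOT summit-strength: without the fatness conjunct the statement
  `Σ_x P(x ↔ ∂ⁱⁿΛ_R in Λ_R) = o(R³)` would force `θ(p_c) = 0` outright (`{x ↔ ∞} ⊆ {x ↔ ∂ⁱⁿΛ_R in Λ_R}`),
  but thin exit pieces (`< R^{3/2}` vertices each, at most `|∂ⁱⁿΛ_R| ≤ 6(2R+1)²` of them, total
  `≤ 25 R^{7/2} ≫ R³`) are unconstrained here — excluding them is exactly the job of the route's other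
  crux `HalfSpaceOneArmRate` (b > 1/2).  Orthodox value: exit mass `≍ Σ_x π(dist(x,∂Λ_R)) ≍ R^{d_f}
  = R^{2.52}`, margin `δ < 0.48` even without fatness.  Known dead sub-routes (sibling crux 4447, line
  `boundary-interior-split-fat-finite-clusters`, `Lines/…-dead.md`): the per-foot union / first-moment
  transport to the wall cluster `U = C_ℍ(0)` overcounts by the number of feet (`≍ R^{1.09}`
  numerically) and is dead at every wall-mass exponent; a `k`-th moment / large-deviation bound for
  `|U ∩ Λ_r|` at `p_c` (k(3−m) > 4) or a one-scale gluing lemma would do.  Size XL, crux-hard.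
* `FreeBoxFatClusterMass_of` — the composition, kernel-checked and `sorry`-free (~120 lines):
  pointwise split on `ω ⊆ E(ℤ³)` (a.s., `ae_subset_edgeSet`), sealed fat piece ⟹ finite cluster of
  `≥ ⌊R^{3/2}⌋ ≥ R` vertices (`mem_piece_of_reachable`), recentring (`openCluster_relabel_shift`,
  `bondPercolation_real_preimage_shift`), `|Λ_R| = (2R+1)³ ≤ 27 R³`, exponents
  `δ := min δ_B c₀`, constant `max C_B 0 + 27 · max C_A 0`.  It concludes the crux BY NAME.

Logical status: crux ⟹ `stub_exitFatMass` trivially (smaller event); crux ⟹̸ `stub_finiteClusterTail`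
(the crux sees finite clusters only through the box, i.e. confined ones); stubs ⟹ crux (this file).
Neither stub implies the crux or the conjunct `PercolationContinuityZ3` by `exact? | simpa | aesop`
(BC3 probes, planner folder `bc/*_probe*.lean`, all FAIL as required).

Disproof / negatives honoured: `Cruxes/FreeBoxFatClusterMass/` had no workfiles before this one (no
`Disproof.lean`, no `_false_without_` theorem); `ledger negatives --problem CriticalPhenomena`
(11 entries, 2026-08-17) has nothing on finite-cluster volume tails or exit-piece mass (the only
free-box entry, stmt-7073 `QuarantineInequality`, is an all-`p` inequality of a different shape).

Layout: §0 the two stub statements as name-keyed `Prop`s (`Sig.stub_*`, def-free bodies over existing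
declarations — the names the composition's hypotheses carry) · §1 helper lemmas valid for every `p`
(the pointwise sealed-piece lemma, the recentring identity, the split in measure) · §2 the two
registered stubs `theorem stub_* : <spelled-out signature> := by sorry` (the only `sorry`s of the
file) · §3 the composition `FreeBoxFatClusterMass_of (hA : Sig.stub_finiteClusterTail)
(hB : Sig.stub_exitFatMass) : …PercBoundarySqueeze.FreeBoxFatClusterMass` (kernel-checked, no
`sorry`, concludes the crux BY NAME) · §4 definitional consistency (`*_registered :
Sig.stub_* := stub_*`) and the crux from the two registered stubs as an `example`.
-/

noncomputable section

namespace Summit.CriticalPhenomena.PercolationContinuityZ3.Cruxes.FreeBoxFatClusterMass.Birth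

open MeasureTheory
open Literature.Probability.Percolation Literature.Probability.LatticeModels
open Summit.CriticalPhenomena.PercolationContinuityZ3.FreeBoxPowerSavingLine.BoundaryInteriorSplit
open scoped Classical BigOperators

/-! ## §0 The two stub statements, name-keyed (what `FreeBoxFatClusterMass_of` takes) -/

namespace Sig

/-- Name-keyed statement of `stub_finiteClusterTail` (power-law upper tail of the FINITE critical
cluster volume on `ℤ³`). [stub statement; open problem] -/
def stub_finiteClusterTail : Prop :=
  ∃ c₀ C : ℝ, 0 < c₀ ∧ ∀ s : ℝ, 1 ≤ s →
    (bondPercolation (zdGraph 3) (criticalProbI 3)).real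
      {ω | (openCluster ω (0 : Site 3)).Finite ∧ s ≤ ((openCluster ω (0 : Site 3)).ncard : ℝ)}
      ≤ C * s ^ (-c₀)

/-- Name-keyed statement of `stub_exitFatMass` (fat EXIT pieces of the free box carry polynomially
sub-volume mass at `p_c(ℤ³)`). [stub statement; open problem] -/
def stub_exitFatMass : Prop :=
  ∃ δ C : ℝ, 0 < δ ∧ ∀ R : ℕ, 1 ≤ R →
    ∑ x ∈ box 3 R, (bondPercolation (zdGraph 3) (criticalProbI 3)).real
      {ω | (∃ T : Finset (Site 3), Nat.sqrt (R ^ 3) ≤ T.card ∧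
          ∀ y ∈ T, ω ∈ openConnIn (↑(box 3 R) : Set (Site 3)) x y) ∧
        ∃ w ∈ innerBoundary (zdGraph 3) (box 3 R),
          ω ∈ openConnIn (↑(box 3 R) : Set (Site 3)) x w}
      ≤ C * (R : ℝ) ^ ((3 : ℝ) - δ)

end Sig

/-! ## §1 Helper lemmas (every `p`) -/

/-- **A sealed fat piece is a finite fat cluster (pointwise).**  If `ω ⊆ E(ℤ³)`, some finset `T` with
`n ≤ #T` (`1 ≤ n`, `R ≤ n`) is joined to `x` inside `Λ_R`, and `x` is NOT joined inside `Λ_R` to any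
vertex of `∂ⁱⁿΛ_R`, then the whole cluster `C(x)` is the piece of `x` (`mem_piece_of_reachable`), hence
finite, and it contains `T`, so `R ≤ |C(x)|`. [folklore] -/
theorem sealed_fat_piece_finite {R n : ℕ} (hRn : R ≤ n) (hn : 1 ≤ n) (x : Site 3)
    {ω : BondConfig (Site 3)} (hω : ω ⊆ (zdGraph 3).edgeSet)
    (hE : ∃ T : Finset (Site 3), n ≤ T.card ∧
      ∀ y ∈ T, ω ∈ openConnIn (↑(box 3 R) : Set (Site 3)) x y)
    (hX : ¬ ∃ w ∈ innerBoundary (zdGraph 3) (box 3 R),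
      ω ∈ openConnIn (↑(box 3 R) : Set (Site 3)) x w) :
    (openCluster ω x).Finite ∧ (R : ℝ) ≤ ((openCluster ω x).ncard : ℝ) := by
  obtain ⟨T, hTcard, hTy⟩ := hE
  have hTne : T.Nonempty := Finset.card_pos.1 (by omega)
  obtain ⟨y₀, hy₀⟩ := hTne
  obtain ⟨hxS, -, -⟩ := hTy y₀ hy₀
  have hx : x ∈ box 3 R := Finset.mem_coe.1 hxS
  -- no vertex of the piece of `x` lies on the inner boundary
  have hfin : (openCluster ω x).Finite := by
    refine (Finset.finite_toSet (box 3 R)).subset fun z hz => ?_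
    exact Finset.mem_coe.2 (Finset.mem_filter.1
      (mem_piece_of_reachable (box 3 R) hω hx
        (fun w hw hwb => hX ⟨w, hwb, (Finset.mem_filter.1 hw).2⟩) hz)).1
  refine ⟨hfin, ?_⟩
  -- `T ⊆ C(x)`
  have hTsub : (↑T : Set (Site 3)) ⊆ openCluster ω x := fun y hy =>
    DCT16.reachable_of_pathIn (DCT16.pathIn_of_mem_openConnIn (hTy y (Finset.mem_coe.1 hy)))
  have h1 : T.card ≤ (openCluster ω x).ncard :=
    (Set.ncard_coe_finset T).symm.le.trans (Set.ncard_le_ncard hTsub hfin)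
  calc (R : ℝ) ≤ n := by exact_mod_cast hRn
    _ ≤ T.card := by exact_mod_cast hTcard
    _ ≤ ((openCluster ω x).ncard : ℝ) := by exact_mod_cast h1

/-- **Recentring.**  The event `{|C(x)| < ∞ ∧ s ≤ |C(x)|}` is the translate of
`{|C(0)| < ∞ ∧ s ≤ |C(0)|}`, so both have the same `P_p`-probability
(`openCluster_relabel_shift`, `bondPercolation_real_preimage_shift`). [folklore] -/
theorem measureReal_finiteTail_shift (p : unitInterval) (s : ℝ) (x : Site 3) :
    (bondPercolation (zdGraph 3) p).real
        {ω | (openCluster ω x).Finite ∧ s ≤ ((openCluster ω x).ncard : ℝ)} =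
      (bondPercolation (zdGraph 3) p).real
        {ω | (openCluster ω (0 : Site 3)).Finite ∧ s ≤ ((openCluster ω (0 : Site 3)).ncard : ℝ)} := by
  have hset : {ω : BondConfig (Site 3) | (openCluster ω x).Finite ∧
        s ≤ ((openCluster ω x).ncard : ℝ)} =
      BondConfig.relabel (sym2Equiv (Site.shift (-x))) ⁻¹'
        {ω | (openCluster ω (0 : Site 3)).Finite ∧
          s ≤ ((openCluster ω (0 : Site 3)).ncard : ℝ)} := by
    ext ω
    simp only [Set.mem_preimage, Set.mem_setOf_eq]
    have h := openCluster_relabel_shift (-x) ω x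
    rw [add_neg_cancel] at h
    rw [h, Set.finite_image_iff (add_left_injective (-x)).injOn,
      Set.ncard_image_of_injective _ (add_left_injective (-x))]
  rw [hset, bondPercolation_real_preimage_shift]

/-- **The split, in measure (every `p`).**  For `x ∈ ℤ³`, `1 ≤ n`, `R ≤ n`:
`P(fat_n(x)) ≤ P(fat_n(x) ∧ x ↔ ∂ⁱⁿΛ_R in Λ_R) + P(|C(0)| < ∞ ∧ R ≤ |C(0)|)`. [folklore] -/
theorem measureReal_fat_le_exit_add_finiteTail (p : unitInterval) {R n : ℕ} (hRn : R ≤ n)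
    (hn : 1 ≤ n) (x : Site 3) :
    (bondPercolation (zdGraph 3) p).real
        {ω | ∃ T : Finset (Site 3), n ≤ T.card ∧
          ∀ y ∈ T, ω ∈ openConnIn (↑(box 3 R) : Set (Site 3)) x y} ≤
      (bondPercolation (zdGraph 3) p).real
        {ω | (∃ T : Finset (Site 3), n ≤ T.card ∧
            ∀ y ∈ T, ω ∈ openConnIn (↑(box 3 R) : Set (Site 3)) x y) ∧
          ∃ w ∈ innerBoundary (zdGraph 3) (box 3 R),
            ω ∈ openConnIn (↑(box 3 R) : Set (Site 3)) x w} +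
      (bondPercolation (zdGraph 3) p).real
        {ω | (openCluster ω (0 : Site 3)).Finite ∧
          (R : ℝ) ≤ ((openCluster ω (0 : Site 3)).ncard : ℝ)} := by
  set μ := bondPercolation (zdGraph 3) p with hμ
  -- the null event `ω ⊄ E(ℤ³)`
  have hN : μ {ω : BondConfig (Site 3) | ¬ ω ⊆ (zdGraph 3).edgeSet} = 0 :=
    ae_iff.1 (ae_subset_edgeSet (zdGraph 3) p)
  have hNr : μ.real {ω : BondConfig (Site 3) | ¬ ω ⊆ (zdGraph 3).edgeSet} = 0 :=
    (measureReal_eq_zero_iff).2 hN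
  -- pointwise inclusion
  have hsub : {ω : BondConfig (Site 3) | ∃ T : Finset (Site 3), n ≤ T.card ∧
          ∀ y ∈ T, ω ∈ openConnIn (↑(box 3 R) : Set (Site 3)) x y} ⊆
      {ω | (∃ T : Finset (Site 3), n ≤ T.card ∧
            ∀ y ∈ T, ω ∈ openConnIn (↑(box 3 R) : Set (Site 3)) x y) ∧
          ∃ w ∈ innerBoundary (zdGraph 3) (box 3 R),
            ω ∈ openConnIn (↑(box 3 R) : Set (Site 3)) x w} ∪
        ({ω | (openCluster ω x).Finite ∧ (R : ℝ) ≤ ((openCluster ω x).ncard : ℝ)} ∪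
          {ω : BondConfig (Site 3) | ¬ ω ⊆ (zdGraph 3).edgeSet}) := by
    intro ω hE
    by_cases hX : ∃ w ∈ innerBoundary (zdGraph 3) (box 3 R),
        ω ∈ openConnIn (↑(box 3 R) : Set (Site 3)) x w
    · exact Or.inl ⟨hE, hX⟩
    · by_cases hω : ω ⊆ (zdGraph 3).edgeSet
      · exact Or.inr (Or.inl (sealed_fat_piece_finite hRn hn x hω hE hX))
      · exact Or.inr (Or.inr hω)
  calc μ.real {ω | ∃ T : Finset (Site 3), n ≤ T.card ∧
          ∀ y ∈ T, ω ∈ openConnIn (↑(box 3 R) : Set (Site 3)) x y}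
      ≤ μ.real ({ω | (∃ T : Finset (Site 3), n ≤ T.card ∧
            ∀ y ∈ T, ω ∈ openConnIn (↑(box 3 R) : Set (Site 3)) x y) ∧
          ∃ w ∈ innerBoundary (zdGraph 3) (box 3 R),
            ω ∈ openConnIn (↑(box 3 R) : Set (Site 3)) x w} ∪
        ({ω | (openCluster ω x).Finite ∧ (R : ℝ) ≤ ((openCluster ω x).ncard : ℝ)} ∪
          {ω : BondConfig (Site 3) | ¬ ω ⊆ (zdGraph 3).edgeSet})) := measureReal_mono hsub
    _ ≤ μ.real {ω | (∃ T : Finset (Site 3), n ≤ T.card ∧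
            ∀ y ∈ T, ω ∈ openConnIn (↑(box 3 R) : Set (Site 3)) x y) ∧
          ∃ w ∈ innerBoundary (zdGraph 3) (box 3 R),
            ω ∈ openConnIn (↑(box 3 R) : Set (Site 3)) x w} +
        (μ.real {ω | (openCluster ω x).Finite ∧ (R : ℝ) ≤ ((openCluster ω x).ncard : ℝ)} +
          μ.real {ω : BondConfig (Site 3) | ¬ ω ⊆ (zdGraph 3).edgeSet}) :=
        (measureReal_union_le _ _).trans (add_le_add le_rfl (measureReal_union_le _ _))
    _ = _ := by rw [hNr, add_zero, measureReal_finiteTail_shift p (R : ℝ) x]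

/-! ## §2 Registered stubs (the only `sorry`s of the file) -/

/-- **Stub A — power-law upper tail for the volume of the FINITE critical cluster on `ℤ³`.**
`∃ c₀ > 0, C: ∀ s ≥ 1, P_{p_c}(|C(0)| < ∞ ∧ s ≤ |C(0)|) ≤ C · s^{−c₀}` ("`1/δ > 0` for finite
clusters"; orthodox `c₀ = τ − 2 ≈ 0.19`).  Jump-free; open for `ℤ³` (Aizenman–Barsky give only the
lower bound `≥ c s^{−1/2}`; Hutchcroft arXiv:1901.10363 Thm 1.1 assumes it).  Verbatim the hypothesis
of `FreeBoxPowerSavingLine.ExchangeRates.confinedQuasiGiantsVanish_of_finiteClusterTail` (sibling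
crux stmt-4447). [stub statement; open problem] -/
theorem stub_finiteClusterTail :
    ∃ c₀ C : ℝ, 0 < c₀ ∧ ∀ s : ℝ, 1 ≤ s →
      (bondPercolation (zdGraph 3) (criticalProbI 3)).real
        {ω | (openCluster ω (0 : Site 3)).Finite ∧ s ≤ ((openCluster ω (0 : Site 3)).ncard : ℝ)}
        ≤ C * s ^ (-c₀) := by
  sorry

/-- **Stub B — fat EXIT pieces of the free box carry polynomially sub-volume mass at `p_c(ℤ³)`.**
`∃ δ > 0, C: ∀ R ≥ 1, Σ_{x ∈ Λ_R} P_{p_c}(|C_{Λ_R}(x)| ≥ ⌊R^{3/2}⌋ ∧ x ↔ ∂ⁱⁿΛ_R inside Λ_R)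
≤ C · R^{3−δ}` (the crux's event intersected with "the piece of `x` touches the inner vertex
boundary").  The jump-branch content of the crux; not summit-strength (thin exit pieces are free);
orthodox margin `δ < 0.48`.  Crux-hard. [stub statement; open problem] -/
theorem stub_exitFatMass :
    ∃ δ C : ℝ, 0 < δ ∧ ∀ R : ℕ, 1 ≤ R →
      ∑ x ∈ box 3 R, (bondPercolation (zdGraph 3) (criticalProbI 3)).real
        {ω | (∃ T : Finset (Site 3), Nat.sqrt (R ^ 3) ≤ T.card ∧
            ∀ y ∈ T, ω ∈ openConnIn (↑(box 3 R) : Set (Site 3)) x y) ∧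
          ∃ w ∈ innerBoundary (zdGraph 3) (box 3 R),
            ω ∈ openConnIn (↑(box 3 R) : Set (Site 3)) x w}
        ≤ C * (R : ℝ) ^ ((3 : ℝ) - δ) := by
  sorry

/-! ## §3 Composition (kernel-checked, no `sorry`): the two stubs give the crux by name -/

/-- **`stub_finiteClusterTail → stub_exitFatMass → FreeBoxFatClusterMass`** (hypotheses carried by
name as `Sig.stub_*`, definitionally the two stub signatures; see §4).  With
`n = ⌊R^{3/2}⌋ ≥ R ≥ 1`: `Σ_x P(fat_n(x)) ≤ Σ_x P(fat_n(x) ∧ exit(x)) + |Λ_R| · P(|C(0)| < ∞ ∧ R ≤ |C(0)|)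
≤ C_B R^{3−δ_B} + (2R+1)³ · C_A R^{−c₀} ≤ (C_B⁺ + 27 C_A⁺) · R^{3 − min(δ_B, c₀)}`. -/
theorem FreeBoxFatClusterMass_of (hA : Sig.stub_finiteClusterTail) (hB : Sig.stub_exitFatMass) :
    Summit.CriticalPhenomena.PercolationContinuityZ3.Theses.PercBoundarySqueeze.FreeBoxFatClusterMass := by
  obtain ⟨c₀, CA, hc₀, hA⟩ := hA
  obtain ⟨δB, CB, hδB, hB⟩ := hB
  refine ⟨min δB c₀, max CB 0 + 27 * max CA 0, lt_min hδB hc₀, ?_⟩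
  intro R hR
  set μ := bondPercolation (zdGraph 3) (criticalProbI 3) with hμ
  -- numerics of the scale
  have hρ1 : (1 : ℝ) ≤ R := by exact_mod_cast hR
  have hρ0 : (0 : ℝ) < R := by linarith
  have hR2 : R ^ 2 ≤ R ^ 3 := Nat.pow_le_pow_right hR (by norm_num)
  have hRn : R ≤ Nat.sqrt (R ^ 3) := Nat.le_sqrt.2 (by simpa [sq] using hR2)
  have hn1 : 1 ≤ Nat.sqrt (R ^ 3) := hR.trans hRn
  -- the finite-cluster tail at threshold `R`
  have hF0 : μ.real {ω | (openCluster ω (0 : Site 3)).Finite ∧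
        (R : ℝ) ≤ ((openCluster ω (0 : Site 3)).ncard : ℝ)} ≤ max CA 0 * (R : ℝ) ^ (-c₀) :=
    (hA (R : ℝ) hρ1).trans
      (mul_le_mul_of_nonneg_right (le_max_left _ _) (Real.rpow_nonneg hρ0.le _))
  -- exponents and the volume of the box
  have hexpB : (R : ℝ) ^ ((3 : ℝ) - δB) ≤ (R : ℝ) ^ ((3 : ℝ) - min δB c₀) :=
    Real.rpow_le_rpow_of_exponent_le hρ1 (by linarith [min_le_left δB c₀])
  have hexpA : (R : ℝ) ^ (3 : ℝ) * (R : ℝ) ^ (-c₀) ≤ (R : ℝ) ^ ((3 : ℝ) - min δB c₀) := by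
    rw [← Real.rpow_add hρ0]
    exact Real.rpow_le_rpow_of_exponent_le hρ1 (by linarith [min_le_right δB c₀])
  have h3 : (R : ℝ) ^ (3 : ℝ) = (R : ℝ) ^ (3 : ℕ) := by exact_mod_cast Real.rpow_natCast (R : ℝ) 3
  have hcard : ((box 3 R).card : ℝ) ≤ 27 * (R : ℝ) ^ (3 : ℝ) := by
    rw [card_box, h3]
    push_cast
    have h : (2 * (R : ℝ) + 1) ^ 3 ≤ (3 * (R : ℝ)) ^ 3 :=
      pow_le_pow_left₀ (by positivity) (by linarith) 3
    linarith [h]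
  -- the two sums
  have hsumB : ∑ x ∈ box 3 R, μ.real
        {ω | (∃ T : Finset (Site 3), Nat.sqrt (R ^ 3) ≤ T.card ∧
            ∀ y ∈ T, ω ∈ openConnIn (↑(box 3 R) : Set (Site 3)) x y) ∧
          ∃ w ∈ innerBoundary (zdGraph 3) (box 3 R),
            ω ∈ openConnIn (↑(box 3 R) : Set (Site 3)) x w} ≤
      max CB 0 * (R : ℝ) ^ ((3 : ℝ) - min δB c₀) :=
    (hB R hR).trans
      ((mul_le_mul_of_nonneg_right (le_max_left _ _) (Real.rpow_nonneg hρ0.le _)).trans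
        (mul_le_mul_of_nonneg_left hexpB (le_max_right _ _)))
  have hsumA : ((box 3 R).card : ℝ) * μ.real {ω | (openCluster ω (0 : Site 3)).Finite ∧
        (R : ℝ) ≤ ((openCluster ω (0 : Site 3)).ncard : ℝ)} ≤
      27 * max CA 0 * (R : ℝ) ^ ((3 : ℝ) - min δB c₀) :=
    calc ((box 3 R).card : ℝ) * μ.real {ω | (openCluster ω (0 : Site 3)).Finite ∧
            (R : ℝ) ≤ ((openCluster ω (0 : Site 3)).ncard : ℝ)}
        ≤ (27 * (R : ℝ) ^ (3 : ℝ)) * (max CA 0 * (R : ℝ) ^ (-c₀)) :=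
          mul_le_mul hcard hF0 measureReal_nonneg (by positivity)
      _ = 27 * max CA 0 * ((R : ℝ) ^ (3 : ℝ) * (R : ℝ) ^ (-c₀)) := by ring
      _ ≤ 27 * max CA 0 * (R : ℝ) ^ ((3 : ℝ) - min δB c₀) :=
          mul_le_mul_of_nonneg_left hexpA (by positivity)
  -- assemble
  calc ∑ x ∈ box 3 R, μ.real {ω | ∃ T : Finset (Site 3), Nat.sqrt (R ^ 3) ≤ T.card ∧
          ∀ y ∈ T, ω ∈ openConnIn (↑(box 3 R) : Set (Site 3)) x y}
      ≤ ∑ x ∈ box 3 R, (μ.real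
          {ω | (∃ T : Finset (Site 3), Nat.sqrt (R ^ 3) ≤ T.card ∧
              ∀ y ∈ T, ω ∈ openConnIn (↑(box 3 R) : Set (Site 3)) x y) ∧
            ∃ w ∈ innerBoundary (zdGraph 3) (box 3 R),
              ω ∈ openConnIn (↑(box 3 R) : Set (Site 3)) x w} +
          μ.real {ω | (openCluster ω (0 : Site 3)).Finite ∧
            (R : ℝ) ≤ ((openCluster ω (0 : Site 3)).ncard : ℝ)}) :=
        Finset.sum_le_sum fun x _ =>
          measureReal_fat_le_exit_add_finiteTail (criticalProbI 3) hRn hn1 x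
    _ = ∑ x ∈ box 3 R, μ.real
          {ω | (∃ T : Finset (Site 3), Nat.sqrt (R ^ 3) ≤ T.card ∧
              ∀ y ∈ T, ω ∈ openConnIn (↑(box 3 R) : Set (Site 3)) x y) ∧
            ∃ w ∈ innerBoundary (zdGraph 3) (box 3 R),
              ω ∈ openConnIn (↑(box 3 R) : Set (Site 3)) x w} +
        ((box 3 R).card : ℝ) * μ.real {ω | (openCluster ω (0 : Site 3)).Finite ∧
            (R : ℝ) ≤ ((openCluster ω (0 : Site 3)).ncard : ℝ)} := by
        rw [Finset.sum_add_distrib, Finset.sum_const, nsmul_eq_mul]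
    _ ≤ max CB 0 * (R : ℝ) ^ ((3 : ℝ) - min δB c₀) +
        27 * max CA 0 * (R : ℝ) ^ ((3 : ℝ) - min δB c₀) := add_le_add hsumB hsumA
    _ = (max CB 0 + 27 * max CA 0) * (R : ℝ) ^ ((3 : ℝ) - min δB c₀) := by ring

/-! ## §4 Definitional consistency: the registered stubs feed the composition verbatim -/

/-- The registered stub A, as spelled out, IS the name-keyed statement `Sig.stub_finiteClusterTail`. -/
theorem finiteClusterTail_registered : Sig.stub_finiteClusterTail := stub_finiteClusterTail

/-- The registered stub B, as spelled out, IS the name-keyed statement `Sig.stub_exitFatMass`. -/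
theorem exitFatMass_registered : Sig.stub_exitFatMass := stub_exitFatMass

/- The crux from the two registered stubs (an `example`, so no `sorry`-tainted proof of the crux
enters the environment). -/
example : Summit.CriticalPhenomena.PercolationContinuityZ3.Theses.PercBoundarySqueeze.FreeBoxFatClusterMass :=
  FreeBoxFatClusterMass_of stub_finiteClusterTail stub_exitFatMass

end Summit.CriticalPhenomena.PercolationContinuityZ3.Cruxes.FreeBoxFatClusterMass.Birth

end
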